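import Literature.NumberTheory.LFunctions.RHConditionalFacts
import Literature.NumberTheory.LFunctions.SchoenfeldPiLarge
import Literature.NumberTheory.LFunctions.SchoenfeldSieve.Chunk00
import Literature.NumberTheory.LFunctions.SchoenfeldSieve.Chunk01
import Literature.NumberTheory.LFunctions.SchoenfeldSieve.Chunk02
import Literature.NumberTheory.LFunctions.SchoenfeldSieve.Chunk03
import Literature.NumberTheory.LFunctions.SchoenfeldSieve.Chunk04
import Literature.NumberTheory.LFunctions.SchoenfeldSieve.Chunk05
import Literature.NumberTheory.LFunctions.SchoenfeldSieve.Chunk06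
import Literature.NumberTheory.LFunctions.SchoenfeldSieve.Chunk07
import Literature.NumberTheory.LFunctions.SchoenfeldSieve.Chunk08
import Literature.NumberTheory.LFunctions.SchoenfeldSieve.Chunk09
import Literature.NumberTheory.LFunctions.SchoenfeldSieve.Chunk10
import Literature.NumberTheory.LFunctions.SchoenfeldSieve.Chunk11
import Literature.NumberTheory.LFunctions.SchoenfeldSieve.Chunk12
import Literature.NumberTheory.LFunctions.SchoenfeldSieve.Chunk13
import Literature.NumberTheory.LFunctions.SchoenfeldSieve.Chunk14
import Literature.NumberTheory.LFunctions.SchoenfeldSieve.Chunk15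
import Literature.NumberTheory.LFunctions.SchoenfeldSieve.Chunk16
import Literature.NumberTheory.LFunctions.SchoenfeldSieve.Chunk17
import Literature.NumberTheory.LFunctions.SchoenfeldSieve.Chunk18
import Literature.NumberTheory.LFunctions.SchoenfeldSieve.Chunk19
import HarnessLib

/-!
# Discharge of `Literature.NumberTheory.LFunctions.schoenfeld_explicit` (Schoenfeld 1976, Cor. 1 (6.18))

Topic: `Literature/NumberTheory/LFunctions`. THEOREM (no new facts):
`theorem schoenfeld_explicit_holds : schoenfeld_explicit`, i.e. **under the Riemann hypothesis,
`|π(x) − li(x)| < √x log x/(8π)` for every real `x ≥ 2657`** (L. Schoenfeld, *Sharper bounds for the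
Chebyshev functions θ(x) and ψ(x). II*, Math. Comp. 30 (1976), Cor. 1 (6.18)).

The three ranges:
* `x ≥ 10⁸`: `SchoenfeldBound.abs_primeCounting_sub_logIntegral_lt_of_ge` (`SchoenfeldPiLarge.lean`; the
  explicit formula for `ψ₁` differenced at `h = 5√x` with the zeros split at `T = 5√x/11`, the tree's
  certified first `2000` zeros and `N(T)`, the `ψ₁`-integration by parts for `∫ (θ − t)/(t log² t)`);
  this is the only place where RH is used;
* `2659 ≤ x < 10⁸`: the certified computation `SchoenfeldSieve.lean` + `SchoenfeldSieve/Chunk00–19.lean`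
  (trial division over the kernel-verified prime table, `li` by Ramanujan's series in fixed point,
  adaptive cells; `computational`, `native_decide`), replacing Schoenfeld's appeal to the tables of Brent and
  Appel–Rosser — `segOK_final`;
* `2657 ≤ x < 2659`: the kernel check `SchoenfeldNumerics.schoenfeld_smallRange` of
  `SchoenfeldExplicitNumerics.lean`.

## References

* L. Schoenfeld, Math. Comp. 30 (1976), 337–360, Thm. 10 and Cor. 1 (6.18), pp. 337–340. [Schoenfeld1976]
* J. B. Rosser, L. Schoenfeld, Math. Comp. 29 (1975), 243–269, Lemmas 7–9. [RosserSchoenfeld1975]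
* R. P. Brent, Math. Comp. 29 (1975), 43–56. [Brent1975]
-/

noncomputable section

open Real

namespace Literature.NumberTheory.LFunctions

open SchoenfeldSieve in
/-- **(6.18) on `[2659, 10⁸)`, certified**: the twenty blocks chained from `π(2658) = 384` to
`π(10⁸ − 1) = 5761455`. [cite: Schoenfeld1976, Cor. 1 (6.18)] -/
theorem SchoenfeldSieve.segOK_final : SchoenfeldSieve.SegOK (10 ^ 8) 5761455 :=
  (segOK_step checkSeg_19 (by norm_num) (by norm_num) (by norm_num) <|
    (segOK_step checkSeg_18 (by norm_num) (by norm_num) (by norm_num) <|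
    (segOK_step checkSeg_17 (by norm_num) (by norm_num) (by norm_num) <|
    (segOK_step checkSeg_16 (by norm_num) (by norm_num) (by norm_num) <|
    (segOK_step checkSeg_15 (by norm_num) (by norm_num) (by norm_num) <|
    (segOK_step checkSeg_14 (by norm_num) (by norm_num) (by norm_num) <|
    (segOK_step checkSeg_13 (by norm_num) (by norm_num) (by norm_num) <|
    (segOK_step checkSeg_12 (by norm_num) (by norm_num) (by norm_num) <|
    (segOK_step checkSeg_11 (by norm_num) (by norm_num) (by norm_num) <|
    (segOK_step checkSeg_10 (by norm_num) (by norm_num) (by norm_num) <|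
    (segOK_step checkSeg_09 (by norm_num) (by norm_num) (by norm_num) <|
    (segOK_step checkSeg_08 (by norm_num) (by norm_num) (by norm_num) <|
    (segOK_step checkSeg_07 (by norm_num) (by norm_num) (by norm_num) <|
    (segOK_step checkSeg_06 (by norm_num) (by norm_num) (by norm_num) <|
    (segOK_step checkSeg_05 (by norm_num) (by norm_num) (by norm_num) <|
    (segOK_step checkSeg_04 (by norm_num) (by norm_num) (by norm_num) <|
    (segOK_step checkSeg_03 (by norm_num) (by norm_num) (by norm_num) <|
    (segOK_step checkSeg_02 (by norm_num) (by norm_num) (by norm_num) <|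
    (segOK_step checkSeg_01 (by norm_num) (by norm_num) (by norm_num) <|
    (segOK_step checkSeg_00 (by norm_num) (by norm_num) (by norm_num) <|
    segOK_start))))))))))))))))))))

/-- **(6.18) below `10⁸`, unconditionally**: `|π(x) − li(x)| < √x log x/(8π)` for `2657 ≤ x < 10⁸`.
[cite: Schoenfeld1976, Cor. 1 (6.18)] -/
theorem abs_primeCounting_sub_logIntegral_lt_of_lt {x : ℝ} (hx : 2657 ≤ x) (hx' : x < (10 : ℝ) ^ 8) :
    |(Nat.primeCounting ⌊x⌋₊ : ℝ) - logIntegral x| < Real.sqrt x * Real.log x / (8 * π) := by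
  by_cases h : x < 2659
  · exact SchoenfeldNumerics.schoenfeld_smallRange x hx h
  · rw [not_lt] at h
    exact SchoenfeldSieve.segOK_final.2 x h (by exact_mod_cast hx')

/-- **Schoenfeld 1976, Cor. 1 (6.18), discharged**: under the Riemann hypothesis,
`|π(x) − li(x)| < √x log x/(8π)` for all `x ≥ 2657`. [cite: Schoenfeld1976, Cor. 1 (6.18)] -/
theorem schoenfeld_explicit_holds : schoenfeld_explicit := by
  intro hRH x hx
  by_cases h8 : x < (10 : ℝ) ^ 8
  · exact abs_primeCounting_sub_logIntegral_lt_of_lt hx h8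
  · exact SchoenfeldBound.abs_primeCounting_sub_logIntegral_lt_of_ge hRH (not_lt.1 h8)

end Literature.NumberTheory.LFunctions

end
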